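import Summits.PneNP.PneNP.Theorems.ChebyshevTracialDesignSmallBlockClassWeights
import Literature.Combinatorics.Optimization.ShellLawClassSplitSum
import Literature.Combinatorics.Optimization.ShellLawPopulationMixture
import HarnessLib

/-!
# Cell pnp-psdrank, route `ChebyshevTracialDesign`: TILTED SMALL BLOCKS — the `HH`-class split of a shell AVERAGE of a
# general cut function (brick 152a; crux `TracialDecayExp20`, stmt-PneNP-19878)

Brick 152a (prover g30; MEMO-33 §2). Lit's (K0-law) `ShellLawPopulationMixture.shellLaw_eq_sum_split_hh_descFactorial` splits the
shell LAW of `|U ∩ H|` along the `HH` class `K = V(AA)` of a block; eng's `ShellLawClassSplitSum.sum_shellIn_filter_class_eq` splits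
a shell SUM of an arbitrary cut function at a fixed class pattern. A TILTED mask `ψ(|U∩H|)·C_u(U)²` is not a function of `|U∩H|`,
but on the class pattern `(f, g)` (`f` full, `g` half `HH`-edges in `U`) its value depends on `U ∩ K` only through the pattern.
This file records the AVERAGE form of the split for such functions, with the SAME multivariate-hypergeometric class weights:

* §1 `class_bookkeeping` (the binomial bookkeeping behind the weights; = lit's private `touch_bookkeeping` at `d = N − a`).
* §2 `sum_shellIn_eq_sum_pattern` — COUNT form: for a `π`-stable class `K ⊆ S` of `a` edges and `F` with
  `F(A ∪ B) = Φ(|A|, |half A|, B)` (`A ⊆ K`, `B ⊆ S∖K`):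
  `Σ_{U∈Shell_S(2s+c,c)} F(U) = Σ_{f≤s} Σ_{g≤c} C(a,f)C(a−f,g)2^g · Σ_{B∈Shell_{S∖K}(2(s−f)+(c−g),c−g)} Φ(2f+g, g, B)`.
* §3 **`shellAvg_eq_sum_classWeight_mul_avg`** — AVERAGE form with the weights
  `C(a,f)C(a−f,g)(s)_f(c)_g(N−s−c)_{a−f−g}/(N)_a` (ranges `f ≤ a`, `g ≤ a−f`; at fixed cut size a polynomial of degree `a` in the
  level, T-K4b `classWeight_eval_level`), `s + c ≤ N`.
WHAT THIS FILE DOES NOT DO: any pricing; anything on `TracialDecayExp20` itself, psd rank of P_PM(K_n), or P vs NP.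
[cite: Rothvoss2017, §2 (PDF p. 6)] [cite: ChattamvelliShanmugam2020, §7.4 (PDF p. 144), multivariate hypergeometric law]
[cite: GodsilMeagher2015, §15.2]
Stature: support/instrument (kernel lane, no defs, axioms standard). Supports stmt-PneNP-19878.
-/

set_option linter.dupNamespace false -- `Summit.PneNP.PneNP.…`: summit = sub-problem (D-0017)

noncomputable section

namespace Summit.PneNP.PneNP.Theorems.ChebyshevTracialDesignTiltedSmallBlockClassSplit

open Finset Literature.Barriers.PneNP Literature.Combinatorics.Optimization
open Literature.Combinatorics.Optimization.ShellStep

variable {n : ℕ}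

/-! ### §1 Bookkeeping -/

/-- The binomial bookkeeping behind the class weights: for `a ≤ N`, `f ≤ s`, `g ≤ c`, `s + c ≤ N`, `f + g ≤ a`,
`C(N−a, s−f)·C(N−a−(s−f), c−g)·2^{c−g}·2^g·(N)_a = C(N,s)·C(N−s,c)·2^c·(s)_f·(c)_g·(N−s−c)_{a−f−g}`
(adapted from `ShellLawPopulationMixture.touch_bookkeeping`, private there).
[cite: ChattamvelliShanmugam2020, §7.1 (binomial-coefficient identities behind the hypergeometric law)] -/
theorem class_bookkeeping (N a s c f g : ℕ) (haN : a ≤ N) (hf : f ≤ s) (hg : g ≤ c)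
    (hsc : s + c ≤ N) (hfg : f + g ≤ a) :
    (N - a).choose (s - f) * (N - a - (s - f)).choose (c - g) * 2 ^ (c - g) * 2 ^ g * N.descFactorial a =
      N.choose s * (N - s).choose c * 2 ^ c *
        (s.descFactorial f * c.descFactorial g * (N - s - c).descFactorial (a - f - g)) := by
  by_cases hcase : (s - f) + (c - g) ≤ N - a
  · have hdesc : ∀ {m j : ℕ}, j ≤ m → (m.descFactorial j : ℚ) = (m.factorial : ℚ) / ((m - j).factorial : ℚ) :=
      fun {m j} hj => by
        rw [eq_div_iff (by positivity), mul_comm]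
        exact_mod_cast Nat.factorial_mul_descFactorial hj
    have q1 : s - f ≤ N - a := by omega
    have q2 : c - g ≤ N - a - (s - f) := by omega
    have q3 : s ≤ N := by omega
    have q4 : c ≤ N - s := by omega
    have q6 : a - f - g ≤ N - s - c := by omega
    have r2 : N - s - c - (a - f - g) = N - a - (s - f) - (c - g) := by omega
    suffices hq : (((N - a).choose (s - f) * (N - a - (s - f)).choose (c - g) * 2 ^ (c - g) * 2 ^ g *
        N.descFactorial a : ℕ) : ℚ) = ((N.choose s * (N - s).choose c * 2 ^ c *
        (s.descFactorial f * c.descFactorial g * (N - s - c).descFactorial (a - f - g)) : ℕ) : ℚ) by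
      exact_mod_cast hq
    push_cast
    rw [Nat.cast_choose ℚ q1, Nat.cast_choose ℚ q2, Nat.cast_choose ℚ q3, Nat.cast_choose ℚ q4,
      hdesc haN, hdesc hf, hdesc hg, hdesc q6, r2]
    have hpow : (2 : ℚ) ^ (c - g) * 2 ^ g = 2 ^ c := by rw [← pow_add, Nat.sub_add_cancel hg]
    rw [← hpow]
    field_simp
  · push Not at hcase
    have hz : (N - s - c).descFactorial (a - f - g) = 0 :=
      Nat.descFactorial_eq_zero_iff_lt.2 (by omega)
    rw [hz]
    rcases le_or_gt (s - f) (N - a) with h1 | h1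
    · rw [Nat.choose_eq_zero_of_lt (n := N - a - (s - f)) (by omega)]; simp
    · rw [Nat.choose_eq_zero_of_lt h1]; simp

/-! ### §2 The count form -/

section Split

variable {π : Fin n → Fin n} (hπ : ∀ v, π (π v) = v) (hπ' : ∀ v, π v ≠ v)
include hπ hπ'

/-- **Class split of a shell sum, COUNT form.** For `π`-stable `K ⊆ S` with `a` edges (`|reps K| = a`) and a cut function `F` whose
value on `A ∪ B` (`A ⊆ K`, `B ⊆ S ∖ K`) depends on `A` only through `(|A|, |half A|)`:
`Σ_{U∈Shell_S(2s+c,c)} F(U) = Σ_{f≤s} Σ_{g≤c} C(a,f)·C(a−f,g)·2^g · Σ_{B∈Shell_{S∖K}(2(s−f)+(c−g), c−g)} Φ(2f+g, g, B)`.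
[cite: Rothvoss2017, §2 (PDF p. 6)] [cite: GodsilMeagher2015, §15.2] -/
theorem sum_shellIn_eq_sum_pattern {S K : Finset (Fin n)} (hK : ∀ v ∈ K, π v ∈ K) (hKS : K ⊆ S)
    {a : ℕ} (ha : (reps π K).card = a) (s c : ℕ) (F : Finset (Fin n) → ℝ) (Φ : ℕ → ℕ → Finset (Fin n) → ℝ)
    (hF : ∀ A B, A ⊆ K → B ⊆ S \ K → F (A ∪ B) = Φ A.card (half π A).card B) :
    ∑ U ∈ shellIn π S (2 * s + c) c, F U =
      ∑ f ∈ range (s + 1), ∑ g ∈ range (c + 1), ((a.choose f * (a - f).choose g * 2 ^ g : ℕ) : ℝ) *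
        ∑ B ∈ shellIn π (S \ K) (2 * (s - f) + (c - g)) (c - g), Φ (2 * f + g) g B := by
  classical
  have hKcard : K.card = 2 * a := by rw [← ha, two_mul_card_reps hπ hπ' hK]
  rw [← sum_fiberwise_of_maps_to (s := shellIn π S (2 * s + c) c)
    (t := range (s + 1) ×ˢ range (c + 1))
    (g := fun U => ((reps π (full π U ∩ K)).card, (half π U ∩ K).card)) (fun U hU => by
      obtain ⟨hUS, hUt, hUc⟩ := mem_shellIn.1 hU
      simp only [mem_product, mem_range, Nat.lt_succ_iff]
      have hfull : ∀ v ∈ full π U, π v ∈ full π U := fun v hv => by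
        obtain ⟨hvU, hπvU⟩ := mem_full.1 hv
        exact mem_full.2 ⟨hπvU, by rw [hπ]; exact hvU⟩
      have h2 := two_mul_card_reps hπ hπ' hfull
      have h3 := card_full_add_card_half (π := π) U
      have h4 : (reps π (full π U ∩ K)).card ≤ (reps π (full π U)).card :=
        card_le_card (fun v hv => by
          rw [mem_reps] at hv ⊢
          exact ⟨(mem_inter.1 hv.1).1, hv.2⟩)
      have h5 : (half π U ∩ K).card ≤ (half π U).card := card_le_card inter_subset_left
      constructor <;> omega),
    sum_product]
  refine sum_congr rfl fun f hf => sum_congr rfl fun g hg => ?_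
  have hf' : f ≤ s := Nat.lt_succ_iff.1 (mem_range.1 hf)
  have hg' : g ≤ c := Nat.lt_succ_iff.1 (mem_range.1 hg)
  have e : ((shellIn π S (2 * s + c) c).filter fun U =>
      ((reps π (full π U ∩ K)).card, (half π U ∩ K).card) = (f, g)) =
      (shellIn π S (2 * s + c) c).filter fun U => (U ∩ K).card = 2 * f + g ∧ (half π U ∩ K).card = g := by
    refine filter_congr fun U _ => ?_
    have hcl := card_inter_class_eq hπ hπ' (U := U) hK
    simp only [Prod.mk.injEq]
    constructor
    · rintro ⟨h1, h2⟩; exact ⟨by omega, h2⟩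
    · rintro ⟨h1, h2⟩; exact ⟨by omega, h2⟩
  rw [e, sum_shellIn_filter_class_eq hπ hK hKS (by omega) hg' F]
  have e1 : 2 * s + c - (2 * f + g) = 2 * (s - f) + (c - g) := by omega
  rw [e1]
  have hinner : ∀ A ∈ shellIn π K (2 * f + g) g,
      ∑ B ∈ shellIn π (S \ K) (2 * (s - f) + (c - g)) (c - g), F (A ∪ B) =
        ∑ B ∈ shellIn π (S \ K) (2 * (s - f) + (c - g)) (c - g), Φ (2 * f + g) g B := by
    intro A hA
    obtain ⟨hAK, hAt, hAc⟩ := mem_shellIn.1 hA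
    refine sum_congr rfl fun B hB => ?_
    rw [hF A B hAK (mem_shellIn.1 hB).1, hAt, hAc]
  rw [sum_congr rfl hinner, sum_const, nsmul_eq_mul, card_shellIn_eq_choose hπ hπ' hK hKcard f g]

/-! ### §3 The average form with the class weights -/

/-- **Class split of a shell AVERAGE** with the multivariate-hypergeometric class weights, ranges `f ≤ s`, `g ≤ c`: for `π`-stable
`S` with `N` edges, `π`-stable `K ⊆ S` with `a` edges, `s + c ≤ N`, and `F` as in `sum_shellIn_eq_sum_pattern`:
`E_{Shell_S(2s+c,c)}[F] = Σ_{f≤s} Σ_{g≤c} C(a,f)C(a−f,g)(s)_f(c)_g(N−s−c)_{a−f−g}/(N)_a · E_{Shell_{S∖K}(2(s−f)+(c−g),c−g)}[Φ(2f+g,g,·)]`.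
[cite: Rothvoss2017, §2 (PDF p. 6)] [cite: ChattamvelliShanmugam2020, §7.4 (PDF p. 144), multivariate hypergeometric law] -/
theorem shellAvg_eq_sum_classWeight_mul_avg' {S K : Finset (Fin n)} (hS : ∀ v ∈ S, π v ∈ S) {N : ℕ} (hN : S.card = 2 * N)
    (hK : ∀ v ∈ K, π v ∈ K) (hKS : K ⊆ S) {a : ℕ} (ha : (reps π K).card = a) (s c : ℕ) (hsc : s + c ≤ N)
    (F : Finset (Fin n) → ℝ) (Φ : ℕ → ℕ → Finset (Fin n) → ℝ)
    (hF : ∀ A B, A ⊆ K → B ⊆ S \ K → F (A ∪ B) = Φ A.card (half π A).card B) :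
    (∑ U ∈ shellIn π S (2 * s + c) c, F U) / ((shellIn π S (2 * s + c) c).card : ℝ) =
      ∑ f ∈ range (s + 1), ∑ g ∈ range (c + 1),
        ((a.choose f : ℝ) * ((a - f).choose g : ℝ) * (s.descFactorial f : ℝ) * (c.descFactorial g : ℝ) *
            ((N - s - c).descFactorial (a - f - g) : ℝ) / (N.descFactorial a : ℝ)) *
          ((∑ B ∈ shellIn π (S \ K) (2 * (s - f) + (c - g)) (c - g), Φ (2 * f + g) g B) /
            ((shellIn π (S \ K) (2 * (s - f) + (c - g)) (c - g)).card : ℝ)) := by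
  classical
  have hKcard : K.card = 2 * a := by rw [← ha, two_mul_card_reps hπ hπ' hK]
  have haN : a ≤ N := by have := card_le_card hKS; omega
  have hT : ∀ v ∈ S \ K, π v ∈ S \ K := by
    intro v hv
    rw [mem_sdiff] at hv ⊢
    exact ⟨hS v hv.1, fun h => hv.2 (by have := hK _ h; rwa [hπ] at this)⟩
  have hTcard : (S \ K).card = 2 * (N - a) := by
    rw [card_sdiff_of_subset hKS, hN, hKcard]; omega
  rw [sum_shellIn_eq_sum_pattern hπ hπ' hK hKS ha s c F Φ hF, card_shellIn_eq_choose hπ hπ' hS hN s c, sum_div]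
  refine sum_congr rfl fun f hf => ?_
  rw [sum_div]
  refine sum_congr rfl fun g hg => ?_
  have hf' : f ≤ s := Nat.lt_succ_iff.1 (mem_range.1 hf)
  have hg' : g ≤ c := Nat.lt_succ_iff.1 (mem_range.1 hg)
  rw [card_shellIn_eq_choose hπ hπ' hT hTcard (s - f) (c - g)]
  set L := ∑ B ∈ shellIn π (S \ K) (2 * (s - f) + (c - g)) (c - g), Φ (2 * f + g) g B with hL
  have hD : ((N.choose s * (N - s).choose c * 2 ^ c : ℕ) : ℝ) ≠ 0 := by
    have h1 : 0 < N.choose s := Nat.choose_pos (by omega)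
    have h2 : 0 < (N - s).choose c := Nat.choose_pos (by omega)
    positivity
  have hFa : (N.descFactorial a : ℝ) ≠ 0 := by
    have := Nat.descFactorial_pos.2 haN
    exact_mod_cast this.ne'
  by_cases hfg : f + g ≤ a
  · have hb := class_bookkeeping N a s c f g haN hf' hg' hsc hfg
    have hb' := congrArg (fun m : ℕ => (m : ℝ)) hb
    by_cases hE : (((N - a).choose (s - f) * ((N - a) - (s - f)).choose (c - g) * 2 ^ (c - g) : ℕ) : ℝ) = 0
    · -- empty inner shell: both sides vanish
      have hempty : shellIn π (S \ K) (2 * (s - f) + (c - g)) (c - g) = ∅ := by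
        rw [← card_eq_zero, card_shellIn_eq_choose hπ hπ' hT hTcard (s - f) (c - g)]
        exact_mod_cast hE
      have hL0 : L = 0 := by rw [hL, hempty, sum_empty]
      rw [hL0, mul_zero, zero_div, zero_div, mul_zero]
    · rw [div_mul_div_comm, div_eq_div_iff hD (mul_ne_zero hFa hE)]
      push_cast at hb' ⊢
      linear_combination ((a.choose f : ℝ) * ((a - f).choose g : ℝ) * L) * hb'
  · push Not at hfg
    rcases le_or_gt f a with h1 | h1
    · rw [Nat.choose_eq_zero_of_lt (n := a - f) (by omega)]; simp
    · rw [Nat.choose_eq_zero_of_lt h1]; simp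

omit hπ hπ' in
/-- Extending the range of a sum whose summand vanishes from `m` on. [folklore] -/
private theorem sum_range_eq_sum_range_of_vanish {T : ℕ → ℝ} {m K : ℕ} (hmK : m ≤ K)
    (h : ∀ i, m ≤ i → T i = 0) : ∑ i ∈ range m, T i = ∑ i ∈ range K, T i :=
  sum_subset (fun i hi => mem_range.2 (lt_of_lt_of_le (mem_range.1 hi) hmK)) fun i _ hni => h i (by
    simp only [mem_range, not_lt] at hni; exact hni)

/-- **Class split of a shell AVERAGE, ranges `f ≤ a`, `g ≤ a − f`** (the index set of the patterns; at fixed cut size the weight of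
`(f, g)` is the class-weight POLYNOMIAL of degree `a` in the level, T-K4b `classWeight_eval_level`; terms with `f > s` or `g > c`
vanish through `(s)_f`, `(c)_g`). Hypotheses as in `shellAvg_eq_sum_classWeight_mul_avg'`.
[cite: Rothvoss2017, §2 (PDF p. 6)] [cite: ChattamvelliShanmugam2020, §7.4 (PDF p. 144), multivariate hypergeometric law] -/
theorem shellAvg_eq_sum_classWeight_mul_avg {S K : Finset (Fin n)} (hS : ∀ v ∈ S, π v ∈ S) {N : ℕ} (hN : S.card = 2 * N)
    (hK : ∀ v ∈ K, π v ∈ K) (hKS : K ⊆ S) {a : ℕ} (ha : (reps π K).card = a) (s c : ℕ) (hsc : s + c ≤ N)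
    (F : Finset (Fin n) → ℝ) (Φ : ℕ → ℕ → Finset (Fin n) → ℝ)
    (hF : ∀ A B, A ⊆ K → B ⊆ S \ K → F (A ∪ B) = Φ A.card (half π A).card B) :
    (∑ U ∈ shellIn π S (2 * s + c) c, F U) / ((shellIn π S (2 * s + c) c).card : ℝ) =
      ∑ f ∈ range (a + 1), ∑ g ∈ range (a - f + 1),
        ((a.choose f : ℝ) * ((a - f).choose g : ℝ) * (s.descFactorial f : ℝ) * (c.descFactorial g : ℝ) *
            ((N - s - c).descFactorial (a - f - g) : ℝ) / (N.descFactorial a : ℝ)) *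
          ((∑ B ∈ shellIn π (S \ K) (2 * (s - f) + (c - g)) (c - g), Φ (2 * f + g) g B) /
            ((shellIn π (S \ K) (2 * (s - f) + (c - g)) (c - g)).card : ℝ)) := by
  rw [shellAvg_eq_sum_classWeight_mul_avg' hπ hπ' hS hN hK hKS ha s c hsc F Φ hF]
  set T : ℕ → ℕ → ℝ := fun f g =>
    ((a.choose f : ℝ) * ((a - f).choose g : ℝ) * (s.descFactorial f : ℝ) * (c.descFactorial g : ℝ) *
        ((N - s - c).descFactorial (a - f - g) : ℝ) / (N.descFactorial a : ℝ)) *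
      ((∑ B ∈ shellIn π (S \ K) (2 * (s - f) + (c - g)) (c - g), Φ (2 * f + g) g B) /
        ((shellIn π (S \ K) (2 * (s - f) + (c - g)) (c - g)).card : ℝ)) with hT
  have vf_s : ∀ f g, s < f → T f g = 0 := fun f g h => by
    simp only [hT, Nat.descFactorial_eq_zero_iff_lt.2 h, Nat.cast_zero, mul_zero, zero_mul, zero_div]
  have vg_c : ∀ f g, c < g → T f g = 0 := fun f g h => by
    simp only [hT, Nat.descFactorial_eq_zero_iff_lt.2 h, Nat.cast_zero, mul_zero, zero_mul, zero_div]
  have vf_a : ∀ f g, a < f → T f g = 0 := fun f g h => by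
    simp only [hT, Nat.choose_eq_zero_of_lt h, Nat.cast_zero, zero_mul, zero_div]
  have vg_a : ∀ f g, a - f < g → T f g = 0 := fun f g h => by
    simp only [hT, Nat.choose_eq_zero_of_lt h, Nat.cast_zero, mul_zero, zero_mul, zero_div]
  set K' := a + s + c + 1 with hK'
  show ∑ f ∈ range (s + 1), ∑ g ∈ range (c + 1), T f g = ∑ f ∈ range (a + 1), ∑ g ∈ range (a - f + 1), T f g
  have lhs : ∑ f ∈ range (s + 1), ∑ g ∈ range (c + 1), T f g = ∑ f ∈ range K', ∑ g ∈ range K', T f g := by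
    rw [sum_range_eq_sum_range_of_vanish (K := K') (by omega) (fun f hf => by
      exact sum_eq_zero fun g _ => vf_s f g (by omega))]
    exact sum_congr rfl fun f _ =>
      sum_range_eq_sum_range_of_vanish (K := K') (by omega) fun g hg => vg_c f g (by omega)
  have rhs : ∑ f ∈ range (a + 1), ∑ g ∈ range (a - f + 1), T f g = ∑ f ∈ range K', ∑ g ∈ range K', T f g := by
    rw [sum_range_eq_sum_range_of_vanish (K := K') (by omega) (fun f hf => by
      exact sum_eq_zero fun g _ => vf_a f g (by omega))]
    exact sum_congr rfl fun f _ =>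
      sum_range_eq_sum_range_of_vanish (K := K') (by omega) fun g hg => vg_a f g (by omega)
  rw [lhs, rhs]

end Split

end Summit.PneNP.PneNP.Theorems.ChebyshevTracialDesignTiltedSmallBlockClassSplit

end
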